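import Literature.AlgebraicTopology.SingularHomology.BoundaryManifoldFiniteness
import Literature.AlgebraicTopology.SingularHomology.FundamentalClassProofs
import HarnessLib

/-!
# Topological invariance of the boundary of a manifold with boundary
(no smoothness: local homology detects boundary points)

For a Hausdorff space `W : Type u` with an atlas modelled on `EuclideanHalfSpace (n+1)` — no
compatibility condition on the transition maps — Mathlib's boundary `(𝓡∂ (n+1)).boundary W` is, by
definition, the set of points whose *preferred* chart value lies on the hyperplane `{a = 0}`, and
chart independence (`ModelWithCorners.isBoundaryPoint_iff_of_mem_atlas`, `isClosed_boundary`) is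
available in Mathlib only for `C¹` atlases.  Here we prove it for topological atlases, by local
homology (A. Hatcher, *Algebraic Topology* (2002), §3.3, p. 231 "`Hₙ(M | x) ≅ Hₙ(ℝⁿ | 0) ≅ ℤ`" at
interior points, p. 252 "a compact manifold with boundary … `∂M` is an `(n−1)`-manifold"; the
vanishing `Hₖ(ℍ | x) = 0` at points of `∂ℍ` is the standard exercise, e.g. Hatcher §3.3
Exercise 2 / §2.1 Exercise on `ℍⁿ`):

* `IsHalfSpaceChart ψ` — the elementary properties of a partial chart `ψ : W ⇀ ℝ × ℝⁿ` with values
  in the closed half-space `{0 ≤ a}` and target open in it (satisfied by the charts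
  `SmoothHalfChart.pe` of `…BoundaryTransfer` and by `peOf φ` for every open partial homeomorphism
  `φ : W ⇀ EuclideanHalfSpace (n+1)`, in the atlas or not);
* `IsHalfSpaceChart.isZero_localHomology_of_fst_eq_zero` — at a point sent to `{a = 0}` all local
  homology vanishes; `IsHalfSpaceChart.not_isZero_localHomology_of_fst_pos` — at a point sent
  into `{0 < a}`, `Hₙ₊₁(W | y; R) ≠ 0` for `R ≠ 0` (comparison, *across universes*, with
  `Hₙ₊₁(ℝⁿ⁺¹ | ·) ≅ R`: `localHomology.nonempty_linearEquiv_of_homeomorph` and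
  `localHomology.nonempty_linearEquiv` of `…FundamentalClassProofs`);
* **`mem_boundary_iff_isZero_localHomology'`**: `y ∈ ∂W ↔ Hₙ₊₁(W | y; R) = 0`, and
  **`mem_boundary_iff_of_mem_source`**: for *every* open partial homeomorphism
  `φ : W ⇀ EuclideanHalfSpace (n+1)` and `y ∈ φ.source`, `y ∈ ∂W ↔ (φ y)₀ = 0` — the topological
  invariance of the boundary;
* `isClosed_boundary'`, `isOpen_interior'` (no `IsManifold` hypothesis);
* `boundaryTopChart`, `boundaryTopChartedSpace` — `∂W` is a topological `n`-manifold: an atlas of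
  `↥(∂W)` modelled on `EuclideanSpace ℝ (Fin n)` (the hyperplane slices of the charts `pe p`).

Everything is proved; nothing is asserted.

## References

* A. Hatcher, *Algebraic Topology*, CUP 2002, §3.3 pp. 231, 252–253; Thm. 2.20. [HatcherAT2002]
-/

noncomputable section

open CategoryTheory Limits Set Topology Metric
open scoped Manifold

universe u v

namespace Literature.AlgebraicTopology.SingularHomology

open SmoothHalfChart

variable (R : Type v) [CommRing R] (M : Type v) [AddCommGroup M] [Module R M]
variable {n : ℕ} {W : Type u} [TopologicalSpace W]

/-- Vanishing of a module object is transported along linear equivalences across universes. [folklore] -/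
lemma isZero_of_linearEquiv' {A : ModuleCat.{u} R} {B : ModuleCat.{v} R} (f : A ≃ₗ[R] B)
    (h : IsZero A) : IsZero B :=
  haveI := ModuleCat.subsingleton_of_isZero h
  haveI : Subsingleton B := f.symm.injective.subsingleton
  ModuleCat.isZero_of_subsingleton B

/-! ### Half-space partial charts -/

/-- The elementary properties of a **half-space partial chart** `ψ : W ⇀ ℝ × ℝⁿ`: open source,
continuity in both directions, target contained in the closed half-space `{0 ≤ a}` and open in
it. [folklore] -/
structure IsHalfSpaceChart (ψ : PartialEquiv W (ℝ × EuclideanSpace ℝ (Fin n))) : Prop where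
  /-- the source is open -/
  isOpen_source : IsOpen ψ.source
  /-- `ψ` is continuous on its source -/
  continuousOn : ContinuousOn ψ ψ.source
  /-- `ψ⁻¹` is continuous on the target -/
  continuousOn_symm : ContinuousOn ψ.symm ψ.target
  /-- the target lies in the closed half-space -/
  target_subset : ψ.target ⊆ {v | 0 ≤ v.1}
  /-- the target is open in the closed half-space -/
  exists_halfBall : ∀ v ∈ ψ.target, ∃ ε > 0,
    {w : ℝ × EuclideanSpace ℝ (Fin n) | 0 ≤ w.1} ∩ ball v ε ⊆ ψ.target

section PeOf

variable (φ : OpenPartialHomeomorph W (EuclideanHalfSpace (n + 1)))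

/-- An open partial homeomorphism `φ : W ⇀ EuclideanHalfSpace (n+1)` read in `ℝ × ℝⁿ` through the
half-space model `HalfSpaceModel.halfSpaceEquiv`. [folklore] -/
def peOf : PartialEquiv W (ℝ × EuclideanSpace ℝ (Fin n)) :=
  φ.toPartialEquiv.trans (HalfSpaceModel.halfSpaceEquiv n)

/-- `peOf φ` has the source of `φ`. [folklore] -/
lemma peOf_source : (peOf φ).source = φ.source := by
  simp [peOf, PartialEquiv.trans_source, HalfSpaceModel.halfSpaceEquiv_source]

/-- `peOf φ`, unfolded. [folklore] -/
lemma peOf_apply (y : W) : peOf φ y = HalfSpaceModel.halfSpaceEquiv n (φ y) := rfl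

/-- The first component of `peOf φ y` is the first model coordinate of `φ y`. [folklore] -/
lemma peOf_apply_fst (y : W) : (peOf φ y).1 = (φ y).1 0 :=
  HalfSpaceModel.halfSpaceEquiv_apply_fst n _

/-- Membership in the target of `peOf φ`. [folklore] -/
lemma mem_peOf_target_iff (v : ℝ × EuclideanSpace ℝ (Fin n)) :
    v ∈ (peOf φ).target ↔ 0 ≤ v.1 ∧ (HalfSpaceModel.halfSpaceEquiv n).symm v ∈ φ.target := by
  simp only [peOf, PartialEquiv.trans_target, HalfSpaceModel.halfSpaceEquiv_target, mem_inter_iff,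
    mem_setOf_eq, mem_preimage]

/-- `peOf φ` is a half-space partial chart. [folklore] -/
theorem isHalfSpaceChart_peOf : IsHalfSpaceChart (peOf φ) where
  isOpen_source := by rw [peOf_source]; exact φ.open_source
  continuousOn := by
    rw [peOf_source]
    exact (HalfSpaceModel.continuous_halfSpaceEquiv n).comp_continuousOn φ.continuousOn
  continuousOn_symm := by
    show ContinuousOn (fun v ↦ φ.symm ((HalfSpaceModel.halfSpaceEquiv n).symm v)) (peOf φ).target
    exact φ.continuousOn_symm.comp (HalfSpaceModel.continuous_halfSpaceEquiv_symm n).continuousOn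
      (fun v hv ↦ ((mem_peOf_target_iff φ v).1 hv).2)
  target_subset v hv := ((mem_peOf_target_iff φ v).1 hv).1
  exists_halfBall v hv := by
    have hO : IsOpen ((HalfSpaceModel.halfSpaceEquiv n).symm ⁻¹' φ.target) :=
      (HalfSpaceModel.continuous_halfSpaceEquiv_symm n).isOpen_preimage _ φ.open_target
    obtain ⟨ε, hε, hball⟩ := Metric.isOpen_iff.1 hO v ((mem_peOf_target_iff φ v).1 hv).2
    exact ⟨ε, hε, fun w hw ↦ (mem_peOf_target_iff φ w).2 ⟨hw.1, hball hw.2⟩⟩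

end PeOf

/-- The charts `SmoothHalfChart.pe x₀` are half-space partial charts. [folklore] -/
theorem isHalfSpaceChart_pe [ChartedSpace (EuclideanHalfSpace (n + 1)) W] (x₀ : W) :
    IsHalfSpaceChart (pe n x₀) where
  isOpen_source := isOpen_pe_source n x₀
  continuousOn := continuousOn_pe n x₀
  continuousOn_symm := continuousOn_pe_symm n x₀
  target_subset := pe_target_subset n x₀
  exists_halfBall _ hv := exists_halfBall_subset_pe_target_of_mem x₀ hv

/-! ### Local homology at the two kinds of chart points -/

namespace IsHalfSpaceChart

variable {R M}
variable [T2Space W] {ψ : PartialEquiv W (ℝ × EuclideanSpace ℝ (Fin n))} (hψ : IsHalfSpaceChart ψ)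
include hψ

/-- **Local homology vanishes at chart-hyperplane points** of a half-space partial chart: if
`(ψ y)₀ = 0` then `Hₖ(W | y; M) = 0` for all `k` (convex half ball around `ψ y` and its star-convex
puncture; cf. `isZero_localHomology_of_pe_fst_eq_zero`). [cite: HatcherAT2002, §3.3 p. 231 and p. 252] -/
theorem isZero_localHomology_of_fst_eq_zero {y : W} (hy : y ∈ ψ.source) (hy0 : (ψ y).1 = 0)
    (k : ℕ) : IsZero (localHomology R M W y k) := by
  obtain ⟨ε, hε, hsub⟩ := hψ.exists_halfBall _ (ψ.map_source hy)
  set v : ℝ × EuclideanSpace ℝ (Fin n) := ψ y with hv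
  set C : Set (ℝ × EuclideanSpace ℝ (Fin n)) := {w | 0 ≤ w.1} ∩ ball v ε with hC
  set U : Set W := ψ.source ∩ ψ ⁻¹' ball v ε with hU
  have hUo : IsOpen U := hψ.continuousOn.isOpen_inter_preimage hψ.isOpen_source isOpen_ball
  have hyU : y ∈ U := ⟨hy, mem_ball_self hε⟩
  have hUs : U ⊆ ψ.source := inter_subset_left
  have hCt : C ⊆ ψ.target := hsub
  have h₁ : MapsTo ψ U C := fun x hx ↦ ⟨hψ.target_subset (ψ.map_source hx.1), hx.2⟩
  have h₂ : MapsTo ψ.symm C U := fun w hw ↦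
    ⟨ψ.map_target (hCt hw), by
      show ψ (ψ.symm w) ∈ ball v ε
      rw [ψ.right_inv (hCt hw)]
      exact hw.2⟩
  have hvC : v ∈ C := h₁ hyU
  have hv0 : v.1 = 0 := hy0
  have hCc : Convex ℝ C := convex_fst_nonneg.inter (convex_ball v ε)
  let φ : ↥U ≃ₜ ↥C := ψ.homeomorphOfMapsTo hψ.continuousOn hψ.continuousOn_symm hUs hCt h₁ h₂
  haveI : ContractibleSpace ↥C := hCc.contractibleSpace ⟨v, hvC⟩
  haveI : ContractibleSpace ↥U := φ.contractibleSpace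
  set q : ℝ × EuclideanSpace ℝ (Fin n) := (ε / 2, v.2) with hq
  have hqv : dist q v = ε / 2 := by
    rw [Prod.dist_eq, Real.dist_eq, hv0, sub_zero, abs_of_pos (half_pos hε), dist_self,
      max_eq_left (half_pos hε).le]
  have hqC : q ∈ C := ⟨(half_pos hε).le, by rw [mem_ball, hqv]; linarith⟩
  have hqne : q ≠ v := fun h ↦ by
    have h1 : ε / 2 = v.1 := congrArg Prod.fst h
    rw [hv0] at h1
    exact (half_pos hε).ne' h1
  have hstar : StarConvex ℝ q (C \ {v}) := by
    intro w hw a b ha hb hab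
    refine ⟨hCc hqC hw.1 ha hb hab, fun h ↦ ?_⟩
    rw [mem_singleton_iff] at h
    have h1 : a * (ε / 2) + b * w.1 = v.1 := by
      have := congrArg Prod.fst h
      simpa only [Prod.fst_add, Prod.smul_fst, smul_eq_mul] using this
    rw [hv0] at h1
    have hw1 : 0 ≤ w.1 := hw.1.1
    have ha0 : a = 0 := by
      nlinarith [mul_nonneg hb hw1, mul_nonneg ha (half_pos hε).le]
    have hb1 : b = 1 := by linarith
    rw [ha0, hb1, zero_smul, one_smul, zero_add] at h
    exact hw.2 h
  haveI : ContractibleSpace ↥(C \ {v}) := hstar.contractibleSpace ⟨q, hqC, hqne⟩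
  have h₁' : MapsTo ψ (U \ {y}) (C \ {v}) := fun x hx ↦ ⟨h₁ hx.1, fun h ↦ hx.2 (by
      rw [mem_singleton_iff] at h ⊢
      exact ψ.injOn (hUs hx.1) hy h)⟩
  have h₂' : MapsTo ψ.symm (C \ {v}) (U \ {y}) := fun w hw ↦ ⟨h₂ hw.1, fun h ↦ hw.2 (by
      rw [mem_singleton_iff] at h ⊢
      rw [← ψ.right_inv (hCt hw.1), h])⟩
  let ψ' : ↥(U \ {y}) ≃ₜ ↥(C \ {v}) := ψ.homeomorphOfMapsTo hψ.continuousOn hψ.continuousOn_symm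
    (Set.sdiff_subset.trans hUs) (Set.sdiff_subset.trans hCt) h₁' h₂'
  haveI : ContractibleSpace ↥(U \ {y}) := ψ'.contractibleSpace
  haveI : ContractibleSpace ↥(({(⟨y, hyU⟩ : ↥U)}ᶜ : Set ↥U)) :=
    (subtypeComplSingletonHomeomorph (⟨y, hyU⟩ : ↥U)).contractibleSpace
  have h0 := isZero_localHomologyOfSet_of_contractibleSpace R M (X := ↥U) {⟨y, hyU⟩} k
  exact IsZero.of_iso h0 (localHomology.openSubsetIso R M hUo hyU k).symm

/-- **Top local homology does not vanish at chart-interior points** of a half-space partial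
chart: if `0 < (ψ y)₀` then `Hₙ₊₁(W | y; R) ≠ 0` for `R ≠ 0` — a ball `B ⊆ {0 < a}` around `ψ y`
inside the target gives `Hₙ₊₁(W | y) ≅ Hₙ₊₁(ψ⁻¹B | y) ≃ Hₙ₊₁(B | ψ y) ≅ Hₙ₊₁(ℝ × ℝⁿ | ψ y) ≅
Hₙ₊₁(ℝⁿ⁺¹ | ·) ≅ R` (excision twice, the cross-universe comparison `localHomology.xEquiv`, and
Hatcher 2002, §3.3 p. 231 in the form `not_isZero_localHomology`). [cite: HatcherAT2002, §3.3 p. 231] -/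
theorem not_isZero_localHomology_of_fst_pos [Nontrivial R] {y : W} (hy : y ∈ ψ.source)
    (hy0 : 0 < (ψ y).1) : ¬ IsZero (localHomology R R W y (n + 1)) := by
  obtain ⟨ε, hε, hsub⟩ := hψ.exists_halfBall _ (ψ.map_source hy)
  set v : ℝ × EuclideanSpace ℝ (Fin n) := ψ y with hv
  set ρ : ℝ := min ε v.1 with hρ
  have hρ0 : 0 < ρ := lt_min hε hy0
  have hball : ball v ρ ⊆ ψ.target := fun w hw ↦ by
    refine hsub ⟨?_, ball_subset_ball (min_le_left _ _) hw⟩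
    show 0 ≤ w.1
    have h1 : |w.1 - v.1| ≤ dist w v := by rw [Prod.dist_eq, Real.dist_eq]; exact le_max_left _ _
    have h2 : dist w v < ρ := hw
    rw [abs_le] at h1
    linarith [h1.1, min_le_right ε v.1]
  set T : Set W := ψ.source ∩ ψ ⁻¹' ball v ρ with hT
  have hTo : IsOpen T := hψ.continuousOn.isOpen_inter_preimage hψ.isOpen_source isOpen_ball
  have hyT : y ∈ T := ⟨hy, mem_ball_self hρ0⟩
  have h₁ : MapsTo ψ T (ball v ρ) := fun z hz ↦ hz.2
  have h₂ : MapsTo ψ.symm (ball v ρ) T := fun w hw ↦ ⟨ψ.map_target (hball hw), by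
    show ψ (ψ.symm w) ∈ ball v ρ
    rw [ψ.right_inv (hball hw)]
    exact hw⟩
  let φ : ↥T ≃ₜ ↥(ball v ρ) :=
    ψ.homeomorphOfMapsTo hψ.continuousOn hψ.continuousOn_symm inter_subset_left hball h₁ h₂
  intro hZ
  -- excision to the chart piece (universe `u`)
  have h1 : IsZero (localHomology R R (↥T) ⟨y, hyT⟩ (n + 1)) :=
    hZ.of_iso (localHomology.openSubsetIso R R hTo hyT (n + 1))
  -- across universes along `T ≃ₜ ball`
  obtain ⟨e₁⟩ := localHomology.nonempty_linearEquiv_of_homeomorph R R φ ⟨y, hyT⟩ (n + 1)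
  have h2 : IsZero (localHomology R R (↥(ball v ρ)) (φ ⟨y, hyT⟩) (n + 1)) :=
    isZero_of_linearEquiv' R e₁ h1
  -- excision from the ball to `ℝ × ℝⁿ`, then to `ℝⁿ⁺¹` (universe `0`)
  have h3 : IsZero (localHomology R R (ℝ × EuclideanSpace ℝ (Fin n))
      ((φ ⟨y, hyT⟩ : ↥(ball v ρ)) : ℝ × EuclideanSpace ℝ (Fin n)) (n + 1)) :=
    h2.of_iso (localHomology.openSubsetIso R R isOpen_ball (φ ⟨y, hyT⟩).2 (n + 1)).symm
  have h4 : IsZero (localHomology R R (EuclideanSpace ℝ (Fin (n + 1)))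
      ((HalfSpaceModel.split n).symm
        ((φ ⟨y, hyT⟩ : ↥(ball v ρ)) : ℝ × EuclideanSpace ℝ (Fin n))) (n + 1)) :=
    h3.of_iso (localHomology.mapIso R R (HalfSpaceModel.split n).symm _ (n + 1)).symm
  -- `Hₙ₊₁(ℝⁿ⁺¹ | ·; R) ≅ R ≠ 0`
  obtain ⟨e⟩ := localHomology.nonempty_linearEquiv R (n := n + 1)
    ((HalfSpaceModel.split n).symm ((φ ⟨y, hyT⟩ : ↥(ball v ρ)) : ℝ × EuclideanSpace ℝ (Fin n)))
  haveI := ModuleCat.subsingleton_of_isZero h4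
  exact not_subsingleton R e.symm.toEquiv.subsingleton

end IsHalfSpaceChart

/-! ### The boundary: local homology criterion, chart independence, closedness -/

section Boundary

variable [T2Space W] [ChartedSpace (EuclideanHalfSpace (n + 1)) W]

/-- **`y ∈ ∂W ↔ Hₙ₊₁(W | y; R) = 0`** (`R ≠ 0`) for a Hausdorff space `W` charted on the half
space — no compatibility condition on the atlas and no fundamental class (compare
`mem_boundary_iff_isZero_localHomology`, which assumed one): boundary points have vanishing
local homology (`isZero_localHomology_of_pe_fst_eq_zero`), interior points have
`Hₙ₊₁(W | y) ≅ R` (`IsHalfSpaceChart.not_isZero_localHomology_of_fst_pos`).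
[cite: HatcherAT2002, §3.3 p. 231 and p. 252] -/
theorem mem_boundary_iff_isZero_localHomology' [Nontrivial R] (y : W) :
    y ∈ (𝓡∂ (n + 1)).boundary W ↔ IsZero (localHomology R R W y (n + 1)) := by
  constructor
  · intro hy
    exact isZero_localHomology_of_pe_fst_eq_zero R R y (mem_pe_source n y)
      ((mem_boundary_iff_pe_self_fst_eq_zero y).1 hy) (n + 1)
  · intro hZ
    by_contra hy
    have hle : 0 ≤ (pe n y y).1 := pe_target_subset n y ((pe n y).map_source (mem_pe_source n y))
    have h0 : 0 < (pe n y y).1 :=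
      lt_of_le_of_ne hle (Ne.symm fun h ↦ hy ((mem_boundary_iff_pe_self_fst_eq_zero y).2 h))
    exact (isHalfSpaceChart_pe y).not_isZero_localHomology_of_fst_pos (R := R)
      (mem_pe_source n y) h0 hZ

/-- **Boundary points in any half-space partial chart**: for `ψ` a half-space partial chart and
`y ∈ ψ.source`, `y ∈ ∂W ↔ (ψ y)₀ = 0`. [cite: HatcherAT2002, §3.3 p. 252] -/
theorem IsHalfSpaceChart.mem_boundary_iff_fst_eq_zero
    {ψ : PartialEquiv W (ℝ × EuclideanSpace ℝ (Fin n))} (hψ : IsHalfSpaceChart ψ) {y : W}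
    (hy : y ∈ ψ.source) : y ∈ (𝓡∂ (n + 1)).boundary W ↔ (ψ y).1 = 0 := by
  rw [mem_boundary_iff_isZero_localHomology' ℤ y]
  constructor
  · intro hZ
    have hle : 0 ≤ (ψ y).1 := hψ.target_subset (ψ.map_source hy)
    rcases hle.eq_or_lt with h | h
    · exact h.symm
    · exact absurd hZ (hψ.not_isZero_localHomology_of_fst_pos (R := ℤ) hy h)
  · intro h0
    exact hψ.isZero_localHomology_of_fst_eq_zero (R := ℤ) (M := ℤ) hy h0 (n + 1)

/-- **Topological invariance of the boundary.** For *every* open partial homeomorphism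
`φ : W ⇀ EuclideanHalfSpace (n+1)` (in the atlas or not) and `y ∈ φ.source`:
`y ∈ ∂W ↔ (φ y)₀ = 0` — Mathlib's `ModelWithCorners.isBoundaryPoint_iff_of_mem_atlas` without any
differentiability. [cite: HatcherAT2002, §3.3 p. 252] -/
theorem mem_boundary_iff_of_mem_source (φ : OpenPartialHomeomorph W (EuclideanHalfSpace (n + 1)))
    {y : W} (hy : y ∈ φ.source) : y ∈ (𝓡∂ (n + 1)).boundary W ↔ (φ y).1 0 = 0 := by
  rw [← peOf_apply_fst]
  exact (isHalfSpaceChart_peOf φ).mem_boundary_iff_fst_eq_zero (by rwa [peOf_source])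

/-- The same for the charts `pe x₀` of `…BoundaryTransfer` (compare
`SmoothHalfChart.mem_boundary_iff_pe_fst_eq_zero`, which assumed a `C¹` atlas). [folklore] -/
theorem mem_boundary_iff_pe_fst_eq_zero' (x₀ : W) {y : W} (hy : y ∈ (pe n x₀).source) :
    y ∈ (𝓡∂ (n + 1)).boundary W ↔ (pe n x₀ y).1 = 0 :=
  (isHalfSpaceChart_pe x₀).mem_boundary_iff_fst_eq_zero hy

/-- **The interior of a topological manifold with boundary is open** in its preferred charts: the
complement of the boundary is open (no `IsManifold` hypothesis; compare Mathlib's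
`ModelWithCorners.isOpen_interior` for `C¹` atlases). [folklore] -/
theorem isOpen_compl_boundary : IsOpen ((𝓡∂ (n + 1)).boundary W)ᶜ := by
  rw [isOpen_iff_forall_mem_open]
  intro y hy
  refine ⟨(chartAt (EuclideanHalfSpace (n + 1)) y).source ∩
      chartAt (EuclideanHalfSpace (n + 1)) y ⁻¹' {q | 0 < q.1 0}, fun z hz hzB ↦ ?_,
    (chartAt _ y).continuousOn.isOpen_inter_preimage (chartAt _ y).open_source
      (isOpen_lt continuous_const ((PiLp.continuous_apply 2 _ 0).comp continuous_subtype_val)),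
    ⟨mem_chart_source _ y, ?_⟩⟩
  · have h0 : (chartAt (EuclideanHalfSpace (n + 1)) y z).1 0 = 0 :=
      (mem_boundary_iff_of_mem_source (chartAt _ y) hz.1).1 hzB
    have h1 : 0 < (chartAt (EuclideanHalfSpace (n + 1)) y z).1 0 := hz.2
    rw [h0] at h1
    exact lt_irrefl 0 h1
  · show 0 < (chartAt (EuclideanHalfSpace (n + 1)) y y).1 0
    exact lt_of_le_of_ne (chartAt (EuclideanHalfSpace (n + 1)) y y).2 (Ne.symm fun h ↦
      hy ((mem_boundary_iff_of_mem_source (chartAt _ y) (mem_chart_source _ y)).2 h))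

/-- **The boundary of a topological manifold with boundary is closed** (no `IsManifold`
hypothesis; compare Mathlib's `ModelWithCorners.isClosed_boundary`). [folklore] -/
theorem isClosed_boundary' : IsClosed ((𝓡∂ (n + 1)).boundary W) :=
  isOpen_compl_iff.1 isOpen_compl_boundary

/-- **The interior of a topological manifold with boundary is open** (no `IsManifold`
hypothesis). [folklore] -/
theorem isOpen_interior' : IsOpen ((𝓡∂ (n + 1)).interior W) := by
  rw [← ModelWithCorners.compl_boundary]
  exact isOpen_compl_boundary

/-- The boundary of a compact topological manifold with boundary is compact. [folklore] -/
theorem isCompact_boundary [CompactSpace W] : IsCompact ((𝓡∂ (n + 1)).boundary W) :=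
  isClosed_boundary'.isCompact

end Boundary

/-! ### The boundary is a topological `n`-manifold -/

section BoundaryCharts

variable [T2Space W] [ChartedSpace (EuclideanHalfSpace (n + 1)) W]

/-- The hyperplane slice of the chart `pe p` read on the boundary: `b ↦ (pe p b).2 ∈ ℝⁿ`, on the
trace of the source of `pe p`. [folklore] -/
def boundarySliceFun (p : W) (b : ↥(Subtype.val ⁻¹' (pe n p).source :
    Set ↥((𝓡∂ (n + 1)).boundary W))) : EuclideanSpace ℝ (Fin n) :=
  (pe n p b.1.1).2

/-- On the boundary, `pe p` takes values in the hyperplane: `pe p b = (0, slice b)`. [folklore] -/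
lemma pe_eq_of_mem_boundary (p : W) {y : W} (hy : y ∈ (pe n p).source)
    (hyB : y ∈ (𝓡∂ (n + 1)).boundary W) : pe n p y = (0, (pe n p y).2) :=
  Prod.ext ((mem_boundary_iff_pe_fst_eq_zero' p hy).1 hyB) rfl

/-- **The hyperplane slice of `pe p` is an open embedding of `∂W ∩ (pe p).source` into `ℝⁿ`**:
continuous and injective (as `pe p` is, the first coordinate being `0` on `∂W`), and open — the
image of the trace of an open `V ⊆ W` is `{w | (0, w) ∈ target, (pe p)⁻¹(0, w) ∈ V}`, open because
`(pe p)⁻¹` is continuous on the target, itself the trace on `{0 ≤ a}` of an open set. [folklore] -/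
theorem isOpenEmbedding_boundarySliceFun (p : W) :
    IsOpenEmbedding (boundarySliceFun (n := n) p) := by
  refine .of_continuous_injective_isOpenMap ?_ ?_ ?_
  · exact continuous_snd.comp ((continuousOn_pe n p).comp_continuous
      (continuous_subtype_val.comp continuous_subtype_val) (fun b ↦ b.2))
  · intro b b' h
    have hb := pe_eq_of_mem_boundary p b.2 b.1.2
    have hb' := pe_eq_of_mem_boundary p b'.2 b'.1.2
    have h' : pe n p b.1.1 = pe n p b'.1.1 := by
      rw [hb, hb']
      exact Prod.ext rfl h
    exact Subtype.ext (Subtype.ext ((pe n p).injOn b.2 b'.2 h'))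
  · intro S hS
    obtain ⟨S₁, hS₁, rfl⟩ := isOpen_induced_iff.1 hS
    obtain ⟨V', hV', rfl⟩ := isOpen_induced_iff.1 hS₁
    obtain ⟨Ω, hΩ, hΩeq⟩ := (continuousOn_iff'.1 (continuousOn_pe_symm n p)) V' hV'
    have hΩt : IsOpen (peInvModel n p ⁻¹' (chartAt (EuclideanHalfSpace (n + 1)) p).target) :=
      (continuous_peInvModel n p).isOpen_preimage _ (chartAt _ p).open_target
    have hj : Continuous fun w : EuclideanSpace ℝ (Fin n) ↦ ((0 : ℝ), w) :=
      continuous_const.prodMk continuous_id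
    have himage : boundarySliceFun p '' (Subtype.val ⁻¹' (Subtype.val ⁻¹' V')) =
        (fun w : EuclideanSpace ℝ (Fin n) ↦ ((0 : ℝ), w)) ⁻¹'
          (Ω ∩ peInvModel n p ⁻¹' (chartAt (EuclideanHalfSpace (n + 1)) p).target) := by
      ext w
      constructor
      · rintro ⟨b, hb, rfl⟩
        have hbt : pe n p b.1.1 ∈ (pe n p).target := (pe n p).map_source b.2
        have heq : pe n p b.1.1 = (0, boundarySliceFun p b) := pe_eq_of_mem_boundary p b.2 b.1.2
        have hbΩ : pe n p b.1.1 ∈ Ω := by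
          have h1 : pe n p b.1.1 ∈ (pe n p).symm ⁻¹' V' ∩ (pe n p).target := ⟨by
            show (pe n p).symm (pe n p b.1.1) ∈ V'
            rw [(pe n p).left_inv b.2]
            exact hb, hbt⟩
          rw [hΩeq] at h1
          exact h1.1
        rw [heq] at hbΩ hbt
        exact ⟨hbΩ, ((mem_pe_target_iff n p _).1 hbt).2⟩
      · rintro ⟨hwΩ, hwt⟩
        have hwt' : ((0 : ℝ), w) ∈ (pe n p).target := (mem_pe_target_iff n p _).2 ⟨le_rfl, hwt⟩
        have hys : (pe n p).symm (0, w) ∈ (pe n p).source := (pe n p).map_target hwt'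
        have hφy : pe n p ((pe n p).symm (0, w)) = (0, w) := (pe n p).right_inv hwt'
        have hyB : (pe n p).symm (0, w) ∈ (𝓡∂ (n + 1)).boundary W :=
          (mem_boundary_iff_pe_fst_eq_zero' p hys).2 (by rw [hφy])
        have hyV : (pe n p).symm (0, w) ∈ V' := by
          have h1 : ((0 : ℝ), w) ∈ Ω ∩ (pe n p).target := ⟨hwΩ, hwt'⟩
          rw [← hΩeq] at h1
          exact h1.1
        refine ⟨⟨⟨(pe n p).symm (0, w), hyB⟩, hys⟩, hyV, ?_⟩
        show (pe n p ((pe n p).symm (0, w))).2 = w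
        rw [hφy]
    rw [himage]
    exact (hΩ.inter hΩt).preimage hj

/-- **Charts of the boundary**: for `p ∈ ∂W`, the hyperplane slice of `pe p` as an open partial
homeomorphism `↥(∂W) ⇀ ℝⁿ` with `p` in its source (Hatcher 2002, p. 252: "`∂M` is an
`(n−1)`-manifold"). [cite: HatcherAT2002, §3.3 p. 252] -/
def boundaryTopChart (p : ↥((𝓡∂ (n + 1)).boundary W)) :
    OpenPartialHomeomorph ↥((𝓡∂ (n + 1)).boundary W) (EuclideanSpace ℝ (Fin n)) :=
  haveI : Nonempty ↥(Subtype.val ⁻¹' (pe n (p : W)).source : Set ↥((𝓡∂ (n + 1)).boundary W)) :=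
    ⟨⟨p, mem_pe_source n (p : W)⟩⟩
  (((isOpen_pe_source n (p : W)).preimage continuous_subtype_val).isOpenEmbedding_subtypeVal
      |>.toOpenPartialHomeomorph Subtype.val).symm.trans
    ((isOpenEmbedding_boundarySliceFun (p : W)).toOpenPartialHomeomorph (boundarySliceFun (p : W)))

/-- `p` lies in the source of its boundary chart. [folklore] -/
lemma mem_boundaryTopChart_source (p : ↥((𝓡∂ (n + 1)).boundary W)) : p ∈ (boundaryTopChart p).source := by
  rw [boundaryTopChart, OpenPartialHomeomorph.trans_source, OpenPartialHomeomorph.symm_source,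
    IsOpenEmbedding.toOpenPartialHomeomorph_target,
    IsOpenEmbedding.toOpenPartialHomeomorph_source, preimage_univ, inter_univ]
  exact ⟨⟨p, mem_pe_source n (p : W)⟩, rfl⟩

/-- **The boundary of a topological `(n+1)`-manifold with boundary is a topological
`n`-manifold**: an atlas of `↥(∂W)` modelled on `EuclideanSpace ℝ (Fin n)` (the boundary charts
`boundaryTopChart p`).  A definition, not an instance. [cite: HatcherAT2002, §3.3 p. 252] -/
@[reducible]
def boundaryTopChartedSpace : ChartedSpace (EuclideanSpace ℝ (Fin n)) ↥((𝓡∂ (n + 1)).boundary W) where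
  atlas := range boundaryTopChart
  chartAt := boundaryTopChart
  mem_chart_source := mem_boundaryTopChart_source
  chart_mem_atlas p := ⟨p, rfl⟩

/-- With the boundary atlas, `↥(∂W)` of a compact `W` is a compact Hausdorff space charted on
`ℝⁿ`, so that e.g. its homology is finitely generated (`finite_singularHomology_of_compactSpace_holds`). [folklore] -/
theorem finite_singularHomology_boundary [IsNoetherianRing R] [CompactSpace W] (k : ℕ) :
    Module.Finite R (singularHomology R R ↥((𝓡∂ (n + 1)).boundary W) k) := by
  letI := boundaryTopChartedSpace (n := n) (W := W)
  haveI : CompactSpace ↥((𝓡∂ (n + 1)).boundary W) := isCompact_iff_compactSpace.1 isCompact_boundary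
  exact finite_singularHomology_of_compactSpace_holds R _ n k

end BoundaryCharts

end Literature.AlgebraicTopology.SingularHomology
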